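/-
Copyright (c) 2026 the pub-hodgecm-mathlib formalisation cell (harness21).  Prover seat hodgecm-mathlib-LH7-p05 (g0), req620 Track A «(D-RAM) FOUR-FRAME» squad, helper lane on
h413 = stmt-HodgeConjecture-24833 (count-neutral).  β-BOARD row R8-EQ-b «H(ρ) ABOVE THE LOCUS ON THE EQUILATERAL KEY» (β chair F0P3a-p01 (g37) LEDGER #17), FILE EQ-2a.  2026-09-04.
-/
import Summits.HodgeConjecture.HodgeConjecture.Theorems.F0P3cDyRamGlueShellLinearisation              -- ★ p861522 (LH7-p07 (g0)): `normSign_add_eq_of_v_le`, `normSign_eq_one_of_mem_deep`; brings ★ toolkit `normSign_mul_of_fixed`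
import Summits.HodgeConjecture.HodgeConjecture.Theorems.F0P3cDyRamDiagonalCoreHangingPolarisationExplicit -- ★ κH (A1) (LH4-p06 (g3)): `exists_explicit_polarisation_latt_hnf_coreHanging`
import Summits.HodgeConjecture.HodgeConjecture.Theorems.F0P3cDyRamDiagonalGluedClassRepresentatives    -- ★ (iv-c) (LH4-p08 (g2)): `v_mul_map_pow`, `map_mul_map_eq`
import Literature.NumberTheory.LocalFields.WildQuadraticDatumTraceBound                                 -- ★ `trace_bound_of_isRamifiedQuadraticDatum`
import Literature.NumberTheory.Automorphic.UnitaryLatticeTreeWeightedGauss                              -- ★ `v_eq_one_of_v_sub_one_lt_one`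
import HarnessLib

/-!
# Crux `H413`, line LH4 «(D-RAM) FOUR-FRAME» — (β) table, β-BOARD row R8-EQ-b (THE EQUILATERAL KEY, `H(ρ)` ABOVE THE LOCUS), FILE EQ-2a:
# THE POLARISATION OF THE CORE-HANGING CLASS REPRESENTATIVE `latt V_H(1,1,g)` AND ITS SLOT SIGNS, LINEARISED (`t′ = 0` twins of ★ κG-A1 ∕ ★ p861824)

Cell `hodgecm-mathlib` (D-0151), FLOOR 0, crux item H413 = `stmt-HodgeConjecture-24833`, route `HCCMUnconditional`; squad F0∕P3c∕LH4 (β-table fan; β chair F0P3a-p01 (g37), H-line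
junction LH4-p05 (g9)).  THEOREMS ONLY (no `def`, no instance, no notation, no `sorry`, default heartbeats); ★-only imports; lane `--supports stmt-HodgeConjecture-24833 --as helper`
(count-neutral); pays NO row, states NO law.  Consumer: this seat's FILE EQ-2b (the per-representative HEAD on `latt V_H(1,1,g)` over LH7-p08 (g0)'s ★ FILE 2b
`two_mul_card_mul_labelledOddCount_coreHanging_rep_eq`) and FILE EQ-2c (the window assembly over LH7-p07 (g0)'s unit-shell window sums).

THE MATHEMATICS.  `V_H(1,1,g) = (1 0 0; 1 ϖ^ρ 0; 1+g ϖ^ρ ϖ^{2ρ})`, `g` a `σ`-fixed UNIT with `|1 + g| = 1` (★ B7's admissible class representative of the core-hanging stratum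
`H(ρ) = (2ρ, 2ρ, 2ρ)`).
* §1 `isVertexLattice_zero_latt_coreHanging_rep`: its type-0 polarisation is `D(g) = π₀^{−ρ}·(g, 1, −(1+g)⁻¹)` (★ κH (A1) `exists_explicit_polarisation_latt_hnf_coreHanging` at
  `x = ζ = 1`, `y″ = f = g`, the three entries identified by `ring`), all entries fixed and non-zero (`coreHanging_rep_polarisation_fixed_ne_zero`).
* §2 `classSign_mul_labelSign_eq_unit`: the `t′ = 0` twin of ★ p861824 — on the cut `|g + c₀| = |ϖ|^E` (`c₀ = g_β∕g_α` a unit, `E < ρ`, `2d − 1 + E ≤ 2ρ`), for `aβ ∈ U_F^{[ρ]}`,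
  `aγ ∈ U_F^{[2ρ]}`: `ω(D_i)·(ω(class_i)·ω(g g_α + aγ T⁻¹ g_β)) = ω(g_α)·G_i(r)`, `r = g + (1+g)(aβ − 1)` (now a UNIT with `|r + c₀| = |ϖ|^E`), `G₀ = ω(r(r+c₀))`, `G₁ = ω(r+c₀)`,
  `G₂ = ω(−1)ω((1+r)(r+c₀))` — same proof, the unit `1 + g` supplied by hypothesis instead of `|g| < 1`.
HONEST LABEL: count-neutral; R8-EQ ∕ hH ∕ hRest ∕ (β-BAL) ∕ (β) ∕ T₊ OPEN; `HC_CM` is proved only modulo the 7 printed citations (2 remaining named inputs: hLiu418 =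
`stmt-HodgeConjecture-24832`, h413 = `stmt-HodgeConjecture-24833`) until rung 0 closes.
References: [Kottwitz1986BaseChangeUnits] §1 pp. 240–241 · [Rogawski1990] §4.9 Prop. 4.9.1 (a)(b) p. 55 · [LanglandsShelstad1987] §3 · [Serre1979] Ch. V §3 Cor. 3, Ch. XV §2.
-/

set_option autoImplicit false

noncomputable section

namespace Summit.HodgeConjecture.HodgeConjecture.Cruxes.H413.F0P3cDyRamLabelledOddCoreHangingWindowSigns

open Matrix WithZero
open Literature.NumberTheory.Automorphic Literature.NumberTheory.Automorphic.HermitianLattice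
open Literature.NumberTheory.Automorphic.UnitaryLatticeTree Literature.NumberTheory.Automorphic.UnitaryThreeFourFrame
open Literature.NumberTheory.LocalFields Literature.NumberTheory.LocalFields.WildQuadraticDatum
open Summit.HodgeConjecture.HodgeConjecture.Cruxes.H413.F0P3cDyRamDiagonalTorusDefs
open Summit.HodgeConjecture.HodgeConjecture.Cruxes.H413.F0P3cDyRamGlueShellLinearisation (normSign_add_eq_of_v_le normSign_eq_one_of_mem_deep)
open Summit.HodgeConjecture.HodgeConjecture.Cruxes.H413.F0P3cDyRamDiagonalCoreHangingPolarisationExplicit (exists_explicit_polarisation_latt_hnf_coreHanging)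
open Summit.HodgeConjecture.HodgeConjecture.Cruxes.H413.F0P3cDyRamDiagonalGluedClassRepresentatives (v_mul_map_pow map_mul_map_eq)
open scoped Valued WithZero Matrix MatrixGroups

variable {K : Type} [Field K] [Valued K ℤᵐ⁰] {σ : K →+* K} {ϖ : K} {d t : ℕ}

/-! ## §1  The polarisation of the core-hanging class representative -/

omit [Valued K ℤᵐ⁰] in
/-- **THE ENTRIES OF `D(g) = π₀^{−ρ}·(g, 1, −(1+g)⁻¹)` ARE `σ`-FIXED AND NON-ZERO** (`g` fixed, `g ≠ 0`, `1 + g ≠ 0`). [cite: Kottwitz1986BaseChangeUnits, §1 pp. 240–241] -/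
theorem coreHanging_rep_polarisation_fixed_ne_zero (hσ : ∀ a, σ (σ a) = a) {ϖ : K} (hϖ0 : ϖ ≠ 0) (ρ : ℕ) {g : K} (hσg : σ g = g) (hg0 : g ≠ 0) (h1g0 : 1 + g ≠ 0) :
    ∀ j : Fin 3, σ ((![((ϖ * σ ϖ) ^ ρ)⁻¹ * g, ((ϖ * σ ϖ) ^ ρ)⁻¹, -(((ϖ * σ ϖ) ^ ρ)⁻¹ * (1 + g)⁻¹)] : Fin 3 → K) j) =
        (![((ϖ * σ ϖ) ^ ρ)⁻¹ * g, ((ϖ * σ ϖ) ^ ρ)⁻¹, -(((ϖ * σ ϖ) ^ ρ)⁻¹ * (1 + g)⁻¹)] : Fin 3 → K) j ∧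
      (![((ϖ * σ ϖ) ^ ρ)⁻¹ * g, ((ϖ * σ ϖ) ^ ρ)⁻¹, -(((ϖ * σ ϖ) ^ ρ)⁻¹ * (1 + g)⁻¹)] : Fin 3 → K) j ≠ 0 := by
  have hπ0 : ((ϖ * σ ϖ) ^ ρ : K) ≠ 0 := pow_ne_zero _ (mul_ne_zero hϖ0 ((map_ne_zero σ).2 hϖ0))
  have hσπ : σ ((ϖ * σ ϖ) ^ ρ) = (ϖ * σ ϖ) ^ ρ := by rw [map_pow, map_mul_map_eq hσ]
  intro j
  fin_cases j
  · simp only [Fin.zero_eta, Fin.isValue, Matrix.cons_val_zero]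
    exact ⟨by rw [map_mul, map_inv₀, hσπ, hσg], mul_ne_zero (inv_ne_zero hπ0) hg0⟩
  · simp only [Fin.mk_one, Fin.isValue, Matrix.cons_val_one, Matrix.cons_val_zero]
    exact ⟨by rw [map_inv₀, hσπ], inv_ne_zero hπ0⟩
  · simp only [Fin.reduceFinMk, Matrix.cons_val_two, Matrix.tail_cons, Matrix.head_cons]
    exact ⟨by rw [map_neg, map_mul, map_inv₀, map_inv₀, hσπ, map_add, map_one, hσg], neg_ne_zero.2 (mul_ne_zero (inv_ne_zero hπ0) (inv_ne_zero h1g0))⟩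

/-- **THE TYPE-0 POLARISATION OF `latt V_H(1,1,g)` IS `diag(π₀^{−ρ}g, π₀^{−ρ}, −π₀^{−ρ}(1+g)⁻¹)`** (★ κH (A1) `exists_explicit_polarisation_latt_hnf_coreHanging` at `x = ζ = 1`, `y″ = f = g`).
[cite: Kottwitz1986BaseChangeUnits, §1 pp. 240–241] [cite: Rogawski1990, §4.9 Prop. 4.9.1 (a) p. 55] -/
theorem isVertexLattice_zero_latt_coreHanging_rep (hD : IsRamifiedQuadraticDatum σ ϖ d t) (h2 : Valued.v (2 : K) < 1)
    (ρ : ℕ) (hρ : 1 ≤ ρ) {g : K} (hσg : σ g = g) (hg : Valued.v g = 1) (h1g : Valued.v (1 + g) = 1)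
    (V : GL (Fin 3) K) (hV : (V : Matrix (Fin 3) (Fin 3) K) = !![1, 0, 0; 1, ϖ ^ ρ, 0; 1 * 1 + g, ϖ ^ ρ * 1, ϖ ^ (2 * ρ)]) :
    IsVertexLattice σ ϖ (Matrix.diagonal (![((ϖ * σ ϖ) ^ ρ)⁻¹ * g, ((ϖ * σ ϖ) ^ ρ)⁻¹, -(((ϖ * σ ϖ) ^ ρ)⁻¹ * (1 + g)⁻¹)] : Fin 3 → K)) 0
      (latt (V : Matrix (Fin 3) (Fin 3) K)) := by
  obtain ⟨hσ, hvσ, hϖ, -, -, -, -⟩ := id hD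
  have hϖ0 : ϖ ≠ 0 := fun h0 => by rw [h0, map_zero] at hϖ; exact WithZero.coe_ne_zero hϖ.symm
  have hϖ1 : Valued.v ϖ < 1 := by rw [hϖ, ← exp_zero, exp_lt_exp]; norm_num
  have hTr := trace_bound_of_isRamifiedQuadraticDatum hD h2
  have h1g' : Valued.v (1 * 1 + g) = 1 := by rw [one_mul]; exact h1g
  have h1g0 : 1 + g ≠ 0 := fun h => by rw [h, map_zero] at h1g; exact zero_ne_one h1g
  obtain ⟨D, ⟨hD1, hD2, hD0⟩, -, hDV⟩ := exists_explicit_polarisation_latt_hnf_coreHanging hσ hvσ hϖ0 hϖ1 hTr ρ hρ (x := 1) (ζ := 1) (y'' := g)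
    (map_one _) (map_one _) hg h1g' V hV (f := g) hσg (by rw [hσg, map_one, one_mul, sub_self, map_zero]; exact zero_le)
  have hσ1g : σ (1 * 1 + g) = 1 + g := by rw [map_add, map_mul, map_one, hσg, one_mul]
  have hDeq : (![((ϖ * σ ϖ) ^ ρ)⁻¹ * g, ((ϖ * σ ϖ) ^ ρ)⁻¹, -(((ϖ * σ ϖ) ^ ρ)⁻¹ * (1 + g)⁻¹)] : Fin 3 → K) = D := by
    funext j
    fin_cases j
    · simp only [Fin.zero_eta, Fin.isValue, Matrix.cons_val_zero]
      rw [hD0, map_one, hσ1g, one_mul]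
      field_simp
      ring
    · simp only [Fin.mk_one, Fin.isValue, Matrix.cons_val_one, Matrix.cons_val_zero]
      rw [hD1]
    · simp only [Fin.reduceFinMk, Matrix.cons_val_two, Matrix.tail_cons, Matrix.head_cons]
      rw [hD2, map_one, one_mul]
      ring
  rw [hDeq]
  exact hDV

/-! ## §2  The slot signs on the core-hanging representative, linearised -/
/-- **THE SLOT SIGN PRODUCT ON THE CORE-HANGING REPRESENTATIVE (`t′ = 0`), LINEARISED** — the unit-shell twin of ★ p861824 `classSign_mul_labelSign_eq`: `g` a fixed UNIT with
`|1 + g| = 1`, `c₀ = g_β∕g_α` a unit, cut `|g + c₀| = |ϖ|^E` (`E < ρ`, `2d − 1 + E ≤ 2ρ`), `aβ ∈ U_F^{[ρ]}`, `aγ ∈ U_F^{[2ρ]}`, weight `P = π₀^ρ`: the label argument is non-zero and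
`ω(D_i)·(ω(class_i)·ω(g g_α + aγ T⁻¹ g_β)) = ω(g_α)·G_i(r)`, `r = g + (1+g)(aβ − 1)`, `G₀ r = ω(r(r + c₀))`, `G₁ r = ω(r + c₀)`, `G₂ r = ω(−1)·ω((1 + r)(r + c₀))`.
[cite: Kottwitz1986BaseChangeUnits, §1 pp. 240–241] [cite: Serre1979, Ch. XV §2] -/
theorem classSign_mul_labelSign_eq_unit [CompleteSpace K] [Finite 𝓀[K]] (hD : IsRamifiedQuadraticDatum σ ϖ d t)
    {ρ E : ℕ} (hEρ : E < ρ) (hdeep : 2 * d - 1 + E ≤ 2 * ρ)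
    {g : K} (hσg : σ g = g) (hg : Valued.v g = 1) (h1g : Valued.v (1 + g) = 1)
    {gα gβ : K} (hσgα : σ gα = gα) (hσgβ : σ gβ = gβ) (hgα0 : gα ≠ 0) (hc₀ : Valued.v (gβ / gα) = 1)
    (hcut : Valued.v (g + gβ / gα) = Valued.v ϖ ^ E)
    {aβ aγ : K} (hσaβ : σ aβ = aβ) (haβ : Valued.v (aβ - 1) ≤ Valued.v ϖ ^ ρ) (hσaγ : σ aγ = aγ) (haγ : Valued.v (aγ - 1) ≤ Valued.v ϖ ^ (2 * ρ))
    (i : Fin 3) :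
    g * gα + aγ * (aβ + g⁻¹ * (aβ - 1))⁻¹ * gβ ≠ 0 ∧
      normSign σ ((![((ϖ * σ ϖ) ^ ρ)⁻¹ * g, ((ϖ * σ ϖ) ^ ρ)⁻¹, -(((ϖ * σ ϖ) ^ ρ)⁻¹ * (1 + g)⁻¹)] : Fin 3 → K) i) *
          (normSign σ ((![(1 : K), aγ * (aβ + g⁻¹ * (aβ - 1))⁻¹, aγ * (aβ + g⁻¹ * (aβ - 1))⁻¹ * aβ] : Fin 3 → K) i) *
            normSign σ (g * gα + aγ * (aβ + g⁻¹ * (aβ - 1))⁻¹ * gβ)) =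
        normSign σ gα * (![normSign σ ((g + (1 + g) * (aβ - 1)) * ((g + (1 + g) * (aβ - 1)) + gβ / gα)),
          normSign σ ((g + (1 + g) * (aβ - 1)) + gβ / gα),
          normSign σ (-1) * normSign σ ((1 + (g + (1 + g) * (aβ - 1))) * ((g + (1 + g) * (aβ - 1)) + gβ / gα))] : Fin 3 → ℤ) i := by
  classical
  have hD' := hD
  obtain ⟨hσ, hvσ, hϖ, -, -, -, -⟩ := hD'
  have hϖ0 : ϖ ≠ 0 := fun h0 => by rw [h0, map_zero] at hϖ; exact WithZero.coe_ne_zero hϖ.symm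
  have hvϖ : Valued.v ϖ ≠ 0 := (Valuation.ne_zero_iff _).2 hϖ0
  have hϖ1 : Valued.v ϖ < 1 := by rw [hϖ, ← exp_zero, exp_lt_exp]; norm_num
  have hpwlt : ∀ a b : ℕ, Valued.v ϖ ^ a < Valued.v ϖ ^ b ↔ b < a := fun a b => by
    rw [v_varpi_pow hϖ, v_varpi_pow hϖ, exp_lt_exp]; omega
  have hne : ∀ {x : K} {k : ℕ}, Valued.v x = Valued.v ϖ ^ k → x ≠ 0 := fun hx h0 => by
    rw [h0, map_zero] at hx; exact pow_ne_zero _ hvϖ hx.symm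
  have hsq : ∀ x : K, normSign σ x * normSign σ x = 1 := fun x => by unfold normSign; split_ifs <;> norm_num
  -- the letters
  set P : K := (ϖ * σ ϖ) ^ ρ with hP
  set c₀ : K := gβ / gα with hc₀def
  set T : K := aβ + g⁻¹ * (aβ - 1) with hT
  set r : K := g + (1 + g) * (aβ - 1) with hr
  have hσP : σ P = P := by rw [hP, map_pow, map_mul_map_eq hσ]
  have hP0 : P ≠ 0 := hne (v_mul_map_pow hvσ ϖ ρ)
  have hσc₀ : σ c₀ = c₀ := by rw [hc₀def, map_div₀, hσgα, hσgβ]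
  have hg0 : g ≠ 0 := fun h0 => by rw [h0, map_zero] at hg; exact zero_ne_one hg
  have h1g0 : 1 + g ≠ 0 := fun h => by rw [h, map_zero] at h1g; exact zero_ne_one h1g
  have haβ1 : Valued.v aβ = 1 := v_eq_one_of_v_sub_one_lt_one (haβ.trans_lt (pow_lt_one₀ zero_le hϖ1 (by omega)))
  have haγ1 : Valued.v aγ = 1 := v_eq_one_of_v_sub_one_lt_one (haγ.trans_lt (pow_lt_one₀ zero_le hϖ1 (by omega)))
  have haβ0 : aβ ≠ 0 := fun h => by rw [h, map_zero] at haβ1; exact zero_ne_one haβ1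
  have haγ0 : aγ ≠ 0 := fun h => by rw [h, map_zero] at haγ1; exact zero_ne_one haγ1
  have hgT : g * T = r := by rw [hT, hr, mul_add, ← mul_assoc, mul_inv_cancel₀ hg0]; ring
  have hvr : Valued.v r = 1 := by
    rw [hr, Valuation.map_add_eq_of_lt_left _ ?_, hg]
    rw [hg, map_mul, h1g, one_mul]
    exact haβ.trans_lt (pow_lt_one₀ zero_le hϖ1 (by omega))
  have hr0 : r ≠ 0 := fun h0 => by rw [h0, map_zero] at hvr; exact zero_ne_one hvr
  have hTeq : T = g⁻¹ * r := by rw [← hgT, ← mul_assoc, inv_mul_cancel₀ hg0, one_mul]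
  have hT0 : T ≠ 0 := by rw [hTeq]; exact mul_ne_zero (inv_ne_zero hg0) hr0
  have hvrc : Valued.v (r + c₀) = Valued.v ϖ ^ E := by
    rw [show r + c₀ = g + c₀ + (1 + g) * (aβ - 1) by rw [hr]; ring, Valuation.map_add_eq_of_lt_left _ ?_, hcut]
    rw [hcut, map_mul, h1g, one_mul]
    exact haβ.trans_lt ((hpwlt _ _).2 (by omega))
  have hrc0 : r + c₀ ≠ 0 := hne hvrc
  have h1r : 1 + r = (1 + g) * aβ := by rw [hr]; ring
  have h1r0 : 1 + r ≠ 0 := by rw [h1r]; exact mul_ne_zero h1g0 haβ0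
  have hσT : σ T = T := by rw [hT, map_add, map_mul, map_inv₀, map_sub, map_one, hσg, hσaβ]
  have hσr : σ r = r := by rw [hr, map_add, map_mul, map_add, map_sub, map_one, hσg, hσaβ]
  have hσrc : σ (r + c₀) = r + c₀ := by rw [map_add, hσr, hσc₀]
  have hσ1r : σ (1 + r) = 1 + r := by rw [map_add, map_one, hσr]
  have hvgβ : Valued.v gβ = Valued.v gα := by
    rw [← one_mul (Valued.v gα), ← hc₀, hc₀def, map_div₀, div_mul_cancel₀ _ ((Valuation.ne_zero_iff _).2 hgα0)]
  -- the label argument, linearised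
  have hLeq : g * gα + aγ * T⁻¹ * gβ = T⁻¹ * (gα * (r + c₀) + (aγ - 1) * gβ) := by
    rw [hTeq, hc₀def, mul_inv, inv_inv]; field_simp; ring
  have hpert : Valued.v ((aγ - 1) * gβ) ≤ Valued.v ϖ ^ (2 * ρ - E) * Valued.v (gα * (r + c₀)) := by
    rw [map_mul, map_mul, hvrc, hvgβ, show Valued.v ϖ ^ (2 * ρ - E) * (Valued.v gα * Valued.v ϖ ^ E) =
      Valued.v ϖ ^ (2 * ρ) * Valued.v gα by
        rw [mul_comm (Valued.v gα) (Valued.v ϖ ^ E), ← mul_assoc, ← pow_add]; congr 2; omega]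
    gcongr
  have hmain0 : gα * (r + c₀) ≠ 0 := mul_ne_zero hgα0 hrc0
  have hσmain : σ (gα * (r + c₀)) = gα * (r + c₀) := by rw [map_mul, hσgα, hσrc]
  have hσpert : σ ((aγ - 1) * gβ) = (aγ - 1) * gβ := by rw [map_mul, map_sub, map_one, hσaγ, hσgβ]
  have hsum0 : gα * (r + c₀) + (aγ - 1) * gβ ≠ 0 := by
    intro h0
    have hlt : Valued.v ((aγ - 1) * gβ) < Valued.v (gα * (r + c₀)) := by
      refine hpert.trans_lt ?_
      conv_rhs => rw [← one_mul (Valued.v (gα * (r + c₀)))]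
      exact mul_lt_mul_of_pos_right (pow_lt_one₀ zero_le hϖ1 (by omega)) ((Valuation.pos_iff _).2 hmain0)
    have := Valuation.map_add_eq_of_lt_left Valued.v hlt
    rw [h0, map_zero] at this
    exact hmain0 ((Valuation.zero_iff _).1 this.symm)
  have hωL : normSign σ (g * gα + aγ * T⁻¹ * gβ) = normSign σ T * (normSign σ gα * normSign σ (r + c₀)) := by
    rw [hLeq, normSign_mul_of_fixed hD (by rw [map_inv₀, hσT]) (by rw [map_add, hσmain, hσpert]) (inv_ne_zero hT0) hsum0,
      normSign_inv_of_map_eq σ hσT hT0, normSign_add_eq_of_v_le hD hσmain hσpert hmain0 (n := 2 * ρ - E) (by omega) hpert,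
      normSign_mul_of_fixed hD hσgα hσrc hgα0 hrc0]
  have hωT : normSign σ T = normSign σ g * normSign σ r := by
    rw [hTeq, normSign_mul_of_fixed hD (by rw [map_inv₀, hσg]) hσr (inv_ne_zero hg0) hr0, normSign_inv_of_map_eq σ hσg hg0]
  have hωTinv : normSign σ T⁻¹ = normSign σ g * normSign σ r := by rw [normSign_inv_of_map_eq σ hσT hT0, hωT]
  have hωP : normSign σ P⁻¹ = 1 := by
    rw [normSign_inv_of_map_eq σ hσP hP0]
    exact normSign_of_isNorm σ ⟨ϖ ^ ρ, by rw [hP, map_pow, ← mul_pow]⟩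
  have hωaγ : normSign σ aγ = 1 := normSign_eq_one_of_mem_deep hD (by omega) hσaγ haγ
  have hL0 : g * gα + aγ * T⁻¹ * gβ ≠ 0 := by rw [hLeq]; exact mul_ne_zero (inv_ne_zero hT0) hsum0
  refine ⟨hL0, ?_⟩
  fin_cases i
  · -- slot 0: `ω(P⁻¹ g)·(ω(1)·ω(L)) = ω(g_α)·ω(r(r + c₀))`
    simp only [Fin.zero_eta, Fin.isValue, Matrix.cons_val_zero]
    rw [normSign_mul_of_fixed hD (by rw [map_inv₀, hσP]) hσg (inv_ne_zero hP0) hg0, hωP, normSign_one, hωL, hωT,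
      normSign_mul_of_fixed hD hσr hσrc hr0 hrc0]
    linear_combination (normSign σ r * (normSign σ gα * normSign σ (r + c₀))) * hsq g
  · -- slot 1: `ω(P⁻¹)·(ω(aγ T⁻¹)·ω(L)) = ω(g_α)·ω(r + c₀)`
    simp only [Fin.mk_one, Fin.isValue, Matrix.cons_val_one, Matrix.cons_val_zero]
    rw [hωP, normSign_mul_of_fixed hD hσaγ (by rw [map_inv₀, hσT]) haγ0 (inv_ne_zero hT0), hωaγ, hωTinv, hωL, hωT]
    linear_combination (normSign σ gα * normSign σ (r + c₀)) * (hsq g * (normSign σ r * normSign σ r) + hsq r)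
  · -- slot 2: `ω(−P⁻¹(1+g)⁻¹)·(ω(aγ T⁻¹ aβ)·ω(L)) = ω(−1)ω(g_α)·ω((1 + r)(r + c₀))`
    simp only [Fin.reduceFinMk, Matrix.cons_val_two, Matrix.tail_cons, Matrix.head_cons]
    have hσm : σ (P⁻¹ * (1 + g)⁻¹) = P⁻¹ * (1 + g)⁻¹ := by rw [map_mul, map_inv₀, map_inv₀, hσP, map_add, map_one, hσg]
    have hm0 : P⁻¹ * (1 + g)⁻¹ ≠ 0 := mul_ne_zero (inv_ne_zero hP0) (inv_ne_zero h1g0)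
    rw [show -(P⁻¹ * (1 + g)⁻¹) = -1 * (P⁻¹ * (1 + g)⁻¹) by ring,
      normSign_mul_of_fixed hD (by rw [map_neg, map_one]) hσm (by norm_num) hm0,
      normSign_mul_of_fixed hD (by rw [map_inv₀, hσP]) (by rw [map_inv₀, map_add, map_one, hσg]) (inv_ne_zero hP0) (inv_ne_zero h1g0), hωP,
      normSign_inv_of_map_eq σ (by rw [map_add, map_one, hσg]) h1g0,
      normSign_mul_of_fixed hD (by rw [map_mul, hσaγ, map_inv₀, hσT]) hσaβ (mul_ne_zero haγ0 (inv_ne_zero hT0)) haβ0,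
      normSign_mul_of_fixed hD hσaγ (by rw [map_inv₀, hσT]) haγ0 (inv_ne_zero hT0), hωaγ, hωTinv, hωL, hωT,
      normSign_mul_of_fixed hD hσ1r hσrc h1r0 hrc0, h1r, normSign_mul_of_fixed hD (by rw [map_add, map_one, hσg]) hσaβ h1g0 haβ0]
    linear_combination (normSign σ (-1) * normSign σ (1 + g) * normSign σ aβ * normSign σ gα * normSign σ (r + c₀)) *
      (hsq g * (normSign σ r * normSign σ r) + hsq r)

/-! ## §2  Norm-class systems exist -/

end Summit.HodgeConjecture.HodgeConjecture.Cruxes.H413.F0P3cDyRamLabelledOddCoreHangingWindowSigns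

end
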